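import Summits.ABC.ABC.Theorems.CuspFieldPencilGoldenCuspShadow
import Summits.ABC.ABC.Theorems.CuspFieldPencilFiveTorsionDictionary
import Summits.ABC.ABC.Theorems.CuspFieldPencilFiveTorsionPayoff
import HarnessLib

/-!
# Sanity (planner, stub-ideation k3 g8 — NOT a proposal): the route TARGET closes by composition

Once `goldenCuspShadow_proof` (landed p832548) is in the tree, the target item stmt-ABC-26025
`CuspFieldPencil.FiveTorsionClassEpsShape` is the modus-ponens composite of three landed theorems.
A prover lands this file as `Summits/ABC/ABC/Theorems/CuspFieldPencilFiveTorsionClassEpsShape.lean`.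
-/

namespace Summit.ABC.ABC.Theorems

/-- **Target stmt-ABC-26025 `CuspFieldPencil.FiveTorsionClassEpsShape`** (class ε-shape, exponent 1/2,
on the rational-5-torsion class 𝒯₅): payoff ∘ (golden cusp shadow, dictionary). [folklore] -/
theorem fiveTorsionClassEpsShape_proof :
    Summit.ABC.ABC.Theses.CuspFieldPencil.FiveTorsionClassEpsShape :=
  fiveTorsionPayoff_proof goldenCuspShadow_proof fiveTorsionDictionary_proof

end Summit.ABC.ABC.Theorems
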